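/-
Copyright (c) 2026 the pub-hodgecm-mathlib formalisation cell (harness21).  Prover seat hodgecm-mathlib-F0P3a-p06 (g18), 2026-09-02: the integral-side twin of the wild
quadratic norm layer (★ `LocalFields/WildQuadratic*`, B-p14 (g42)) — the DIFFERENT NUMBER of `L_w ∕ L⁺_v` at a ramified CM place, any residue characteristic
(census F0P3a-p06 (g17) `DUNR-H2-CENSUS.md` §4).
-/
import Literature.NumberTheory.Automorphic.RamifiedPlaceEisensteinBasis   -- ★ B-p17 (g25): `toPlace_add_toPlace_mul_mem_integer_iff`, `exists_eq_toPlace_add_toPlace_mul`, `valued_toPlace_add_toPlace_mul`, `valued_toPlace_eq_sq_of_ramified`, …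
import HarnessLib

/-!
# The DIFFERENT NUMBER `d = ord_w(σ_w τ − τ)` of `L_w ∕ L⁺_v` at a RAMIFIED CM place (any residue characteristic): value, `τ`-independence,
# `d = 1 ⟺ tame`, and the parity criterion for a skew UNIFORMISER versus a skew UNIT (Serre, *Local Fields* IV §1 Prop. 4, IV §2; III §6)

Topic `NumberTheory/Automorphic`; namespace `Literature.NumberTheory.Automorphic.UnitaryGroup`.  THEOREMS ONLY (no definition, no instance, no notation, no named fact,
no `sorry`; axioms ⊆ {propext, Classical.choice, Quot.sound}).  Cell `pub/hodgecm-mathlib` (D-0151), crux H413 = `stmt-HodgeConjecture-24833`; half A line LH4, DYADIC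
pay-down leaf `Cruxes/H413/Lines/F0_P3c_DyadicPaydown.lean`, organ (D-RAM) (PRINT by ruling D74′; census F0P3a-p06 (g17) `DUNR-H2-CENSUS.md` §4: the 411-file tame frame
`hσϖ : σ_w ϖ = −ϖ ∧ |2|_w = 1`).  B-p14 (g42)'s ★ layer `LocalFields/WildQuadratic*` (8 files + ★ `WildQuadraticNormsCMBridge`) computes the NORM side of a wild quadratic
place (which `x ∈ L⁺_v` are norms; the conductor `f`); ★ B-p17 (g25) `RamifiedPlaceEisensteinBasis` gives the INTEGRAL BASIS `𝒪_w = 𝒪_v ⊕ 𝒪_v τ` at ANY residue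
characteristic; ★ B-p14 (g32) `RamifiedPlaceAntiFixedDichotomy` gives «an anti-fixed UNIT or an anti-fixed UNIFORMISER exists».  THIS file supplies the one integral-side
invariant the tree did not have: the DIFFERENT NUMBER.  HONEST LABEL: HC_CM is proved only modulo the 7 printed citations (2 remaining named inputs: hLiu418 =
stmt-HodgeConjecture-24832, h413 = stmt-HodgeConjecture-24833) until rung 0 closes; this file is unconditional local algebra, count-neutral, and pays no letter by itself.

SETTING (= ★ `RamifiedPlaceEisensteinBasis`).  `L` CM, `v` a finite place of `L⁺`, `w ∣ v` with `c • w = w` and `e(w|v) ≠ 1`; `F := L⁺_v`, `E := L_w`, `ι = toPlace v w`,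
`σ = σ_w = galAdicCompletionMap c hw` (`σ ∘ ι = ι`, `σσ = 1`, `|σ x| = |x|`, `|ι y| = |y|²`), `τ ∈ E` a uniformiser, `τ + στ = ι u` its trace (★ `exists_eisenstein_coeffs_of_ramified`).
In `𝒪_w = 𝒪_v[τ]` the different is `𝔇_{w∕v} = (g′(τ)) = (τ − στ)` (`g` the Eisenstein polynomial of `τ`), so `d := ord_w(στ − τ) = i_G(σ)` is Serre's `Σ_i (|G_i| − 1)`
[Serre1979, IV §1 Prop. 4]; we never name `𝔇` — every statement is about the VALUE `|σ_w τ − τ|_w ∈ ℤᵐ⁰`.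
* §1 IN THE BASIS: `σ(ι p + ι q τ) − (ι p + ι q τ) = ι q · (στ − τ)` and `|σ x − x| = |q|² · |στ − τ|` (`galAdicCompletionMap_sub_self_toPlace_add_toPlace_mul`,
  `valued_galAdicCompletionMap_sub_self_toPlace_add_toPlace_mul`).
* §2 THE VALUE: `στ − τ = ι u − 2τ` and the two terms have valuations of OPPOSITE PARITY (`|ι u| = |u|²` even, `|2τ| = |2|_v² · exp(−1)` odd), so
  **`valued_galAdicCompletionMap_sub_self_of_uniformizer`**: `|στ − τ| = max |ι u| |2τ|` — i.e. `d = min (2·ord_v(τ + στ), 2·ord_v 2 + 1)`.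
* §3 **`valued_galAdicCompletionMap_sub_self_eq_of_uniformizer`** — `τ`-INDEPENDENCE: `|στ′ − τ′| = |στ − τ|` for any two uniformisers (`τ′ = ι p + ι q τ` forces `|q| = 1`).
* §4 BOUNDS AND TAMENESS: `|2τ| ≤ |στ − τ| ≤ exp(−1)` and **`valued_galAdicCompletionMap_sub_self_eq_exp_neg_one_iff`**: `|στ − τ| = exp(−1) ↔ |2|_w = 1` — `d = 1` EXACTLY at the
  tame places (the scope of the tame frame; at a wild place `2 ≤ d ≤ 2·ord_v 2 + 1`).
* §5 THE SKEW LINE: `σ x = −x ↔ ∃ q, x = ι q · (τ − στ)` (`x ∕ (τ − στ)` is `σ`-fixed), hence every skew element has `ord_w ≡ d (mod 2)` and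
  **`exists_skew_uniformizer_iff`**: `(∃ ϖ, |ϖ| = exp(−1) ∧ σϖ = −ϖ) ↔ |στ − τ| = |2τ|` (`d` odd, `= 2·ord_v 2 + 1`; witness `ϖ = τ − ι u ∕ 2`),
  **`exists_skew_unit_iff`**: `(∃ α, |α| = 1 ∧ σα = −α) ↔ |2τ| < |στ − τ|` (`d` even; witness `α = (τ − στ) ∕ ι u`) — the CRITERION behind ★ AntiFixedDichotomy's «or»,
  and `not_exists_skew_uniformizer_and_skew_unit` (never both).
* §6 RESIDUAL DEPTH: `x ∈ 𝒪_w → |σ x − x| ≤ |στ − τ|` (`σ_w ≡ id (mod 𝔭_w^d)`; sharpens ★ `valued_galAdicCompletionMap_sub_lt_one_of_ramified`), with equality iff the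
  `τ`-coordinate of `x` is a unit.
* §7 ONE PACKAGE `exists_different_of_ramified`: `∃ d : ℕ, 1 ≤ d ∧ (∀ τ uniformiser, |στ − τ| = exp(−d)) ∧ (∀ x ∈ 𝒪_w, |σx − x| ≤ exp(−d)) ∧ (d = 1 ↔ |2|_w = 1) ∧ …`.
(The identity `d = f` with B-p14's conductor — `δ := τ − στ` is a skew generator with `δ² = ι(u² + 4v)`, of odd order iff `ord_v u > ord_v 2`, else in the unit class of odd
defect `2·ord_v 2 + 1 − 2·ord_v u` — is left to a second edition over ★ `IsCMField.conductor_iff_place`.)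

## References
* [Serre1979] J.-P. Serre, *Local Fields*, GTM 67 (1979): Ch. III §6 Prop. 12 ∕ Cor. 2 (`𝔇 = (g′(τ))` for `𝒪_E = 𝒪_F[τ]`), Ch. IV §1 Prop. 4 (`ord 𝔇 = Σ (|G_i| − 1) = i_G(σ)`),
  Ch. IV §2 (the quadratic case; `i_G(σ) = ord(στ − τ)`), Ch. I §6 Prop. 18.
* [NeukirchANT1999] J. Neukirch, *Algebraic Number Theory* (1999): Ch. III §2 (2.4) (different of a monogenic order), Ch. II (6.8)–(6.9).
* [Jacobowitz1962] R. Jacobowitz, *Hermitian forms over local fields*, Amer. J. Math. 84 (1962), §§9–11 (ramified dyadic: the «R-U» `E = F(√u)` ∕ «R-P» `E = F(√π)` dichotomy).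
-/

set_option autoImplicit false

noncomputable section

open NumberField IsDedekindDomain ValuativeRel
open scoped ValuativeRel WithZero

namespace Literature.NumberTheory.Automorphic.UnitaryGroup

variable (L : Type) [Field L] [NumberField L] [IsCMField L] (v : HeightOneSpectrum (𝓞 ↥(maximalRealSubfield L)))
  (w : PlacesOver L v) (hw : IsCMField.complexConj L • w.1 = w.1) (he : v.asIdeal.ramificationIdx' w.1.asIdeal ≠ 1)

/-! ## §0 Two scalar facts in `ℤᵐ⁰` and `2 ≠ 0` -/

/-- In `ℤᵐ⁰`: an even power `x²` is never `y² · exp(−1)` unless both vanish — squares have even exponent. [cite: Serre1979, Ch. II §1] -/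
theorem sq_ne_sq_mul_exp_neg_one {x y : WithZero (Multiplicative ℤ)} (hx : x ≠ 0) (hy : y ≠ 0) : x ^ 2 ≠ y ^ 2 * WithZero.exp (-1 : ℤ) := by
  obtain ⟨m, hm⟩ : ∃ m : ℤ, x = WithZero.exp m := ⟨_, (WithZero.exp_log hx).symm⟩
  obtain ⟨n, hn⟩ : ∃ n : ℤ, y = WithZero.exp n := ⟨_, (WithZero.exp_log hy).symm⟩
  rw [hm, hn, ← WithZero.exp_nsmul, ← WithZero.exp_nsmul, ← WithZero.exp_add, Ne, WithZero.exp_inj]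
  simp only [nsmul_eq_mul, Nat.cast_ofNat]
  omega

/-- In `ℤᵐ⁰`: `x² = 1 → x = 1` (private twin of ★ `UnitaryTwoTreeActionStabilizers`' lemma of the same name, to keep the import closure small). [cite: Serre1979, Ch. II §1] -/
private theorem eq_one_of_sq_eq_one' {x : WithZero (Multiplicative ℤ)} (h : x ^ 2 = 1) : x = 1 :=
  eq_of_sq_eq_sq (by rw [h, one_pow])

omit [IsCMField L] in
/-- `2 ≠ 0` in `L_w` (characteristic zero). [folklore] -/
private theorem two_ne_zero_adicCompletion : (2 : w.1.adicCompletion L) ≠ 0 := by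
  rw [show (2 : w.1.adicCompletion L) = algebraMap L _ 2 by rw [map_ofNat]]
  exact (_root_.map_ne_zero (algebraMap L (w.1.adicCompletion L))).2 two_ne_zero

omit [IsCMField L] in
/-- `2 ≠ 0` in `L⁺_v` (characteristic zero). [folklore] -/
private theorem two_ne_zero_adicCompletion_base : (2 : v.adicCompletion ↥(maximalRealSubfield L)) ≠ 0 := by
  rw [show (2 : v.adicCompletion ↥(maximalRealSubfield L)) = algebraMap ↥(maximalRealSubfield L) _ 2 by rw [map_ofNat]]
  exact (_root_.map_ne_zero (algebraMap ↥(maximalRealSubfield L) (v.adicCompletion ↥(maximalRealSubfield L)))).2 two_ne_zero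

include hw he in
/-- `|2|_w = |2|_v²` at a ramified place (`ι 2 = 2`, ★ `valued_toPlace_eq_sq_of_ramified`). [cite: NeukirchANT1999, Ch. II (6.8)–(6.9)] -/
theorem valued_two_eq_sq_of_ramified :
    Valued.v (2 : w.1.adicCompletion L) = Valued.v (2 : v.adicCompletion ↥(maximalRealSubfield L)) ^ 2 := by
  rw [← map_ofNat (toPlace v w) 2, valued_toPlace_eq_sq_of_ramified L v w hw he]

/-! ## §1 `σ x − x` in the Eisenstein basis -/

/-- **`σ(ι p + ι q τ) − (ι p + ι q τ) = ι q · (στ − τ)`** (`σ` fixes `ι`). [cite: Serre1979, Ch. IV §1] -/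
theorem galAdicCompletionMap_sub_self_toPlace_add_toPlace_mul (τ : w.1.adicCompletion L) (p q : v.adicCompletion ↥(maximalRealSubfield L)) :
    galAdicCompletionMap (L := L) (IsCMField.complexConj L) hw (toPlace v w p + toPlace v w q * τ) - (toPlace v w p + toPlace v w q * τ) =
      toPlace v w q * (galAdicCompletionMap (L := L) (IsCMField.complexConj L) hw τ - τ) := by
  rw [galAdicCompletionMap_toPlace_add_toPlace_mul L v w hw τ p q]
  ring

include he in
/-- **`|σ x − x| = |q|² · |στ − τ|` for `x = ι p + ι q τ`.** [cite: Serre1979, Ch. IV §1 Prop. 4] -/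
theorem valued_galAdicCompletionMap_sub_self_toPlace_add_toPlace_mul (τ : w.1.adicCompletion L) (p q : v.adicCompletion ↥(maximalRealSubfield L)) :
    Valued.v (galAdicCompletionMap (L := L) (IsCMField.complexConj L) hw (toPlace v w p + toPlace v w q * τ) - (toPlace v w p + toPlace v w q * τ)) =
      Valued.v q ^ 2 * Valued.v (galAdicCompletionMap (L := L) (IsCMField.complexConj L) hw τ - τ) := by
  rw [galAdicCompletionMap_sub_self_toPlace_add_toPlace_mul L v w hw τ p q, map_mul, valued_toPlace_eq_sq_of_ramified L v w hw he]

/-! ## §2 The value: `στ − τ = ι u − 2τ`, two terms of opposite parity -/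

/-- `στ − τ = ι u − 2τ` when `τ + στ = ι u`. [cite: Serre1979, Ch. IV §2] -/
theorem galAdicCompletionMap_sub_self_eq_of_trace {τ : w.1.adicCompletion L} {u : v.adicCompletion ↥(maximalRealSubfield L)}
    (htr : τ + galAdicCompletionMap (L := L) (IsCMField.complexConj L) hw τ = toPlace v w u) :
    galAdicCompletionMap (L := L) (IsCMField.complexConj L) hw τ - τ = toPlace v w u - 2 * τ := by
  linear_combination htr

include hw he in
/-- `|2τ|_w = |2|_v² · exp(−1)` for a uniformiser `τ` — an ODD exponent. [cite: Serre1979, Ch. II §2] -/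
theorem valued_two_mul_of_uniformizer {τ : w.1.adicCompletion L} (hτ : Valued.v τ = WithZero.exp (-1 : ℤ)) :
    Valued.v (2 * τ) = Valued.v (2 : v.adicCompletion ↥(maximalRealSubfield L)) ^ 2 * WithZero.exp (-1 : ℤ) := by
  rw [map_mul, valued_two_eq_sq_of_ramified L v w hw he, hτ]

include he in
/-- **THE VALUE OF THE DIFFERENT NUMBER.**  For a uniformiser `τ` with trace `τ + στ = ι u`: `|στ − τ| = max |ι u| |2τ|` — the two terms of `ι u − 2τ` have valuations
`|u|²` (even exponent, or `0`) and `|2|_v² · exp(−1)` (odd exponent), so the ultrametric inequality is an equality.  In exponents: `d = min (2·ord_v u, 2·ord_v 2 + 1)`.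
[cite: Serre1979, Ch. IV §1 Prop. 4, Ch. IV §2] -/
theorem valued_galAdicCompletionMap_sub_self_of_uniformizer {τ : w.1.adicCompletion L} (hτ : Valued.v τ = WithZero.exp (-1 : ℤ))
    {u : v.adicCompletion ↥(maximalRealSubfield L)} (htr : τ + galAdicCompletionMap (L := L) (IsCMField.complexConj L) hw τ = toPlace v w u) :
    Valued.v (galAdicCompletionMap (L := L) (IsCMField.complexConj L) hw τ - τ) = max (Valued.v (toPlace v w u)) (Valued.v (2 * τ)) := by
  rw [galAdicCompletionMap_sub_self_eq_of_trace L v w hw htr, sub_eq_add_neg]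
  rcases eq_or_ne u 0 with hu0 | hu0
  · rw [hu0, map_zero, zero_add, Valuation.map_neg, map_zero, max_eq_right zero_le]
  have hne : Valued.v (toPlace v w u) ≠ Valued.v (-(2 * τ)) := by
    rw [Valuation.map_neg, valued_toPlace_eq_sq_of_ramified L v w hw he, valued_two_mul_of_uniformizer L v w hw he hτ]
    exact sq_ne_sq_mul_exp_neg_one ((Valuation.ne_zero_iff _).2 hu0)
      ((Valuation.ne_zero_iff _).2 (two_ne_zero_adicCompletion_base L v))
  rw [Valuation.map_add_of_distinct_val _ hne, Valuation.map_neg]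

include he in
/-- The same value in `L⁺_v`-letters: `|στ − τ| = max (|u|²) (|2|_v² · exp(−1))`. [cite: Serre1979, Ch. IV §1 Prop. 4, Ch. IV §2] -/
theorem valued_galAdicCompletionMap_sub_self_of_uniformizer' {τ : w.1.adicCompletion L} (hτ : Valued.v τ = WithZero.exp (-1 : ℤ))
    {u : v.adicCompletion ↥(maximalRealSubfield L)} (htr : τ + galAdicCompletionMap (L := L) (IsCMField.complexConj L) hw τ = toPlace v w u) :
    Valued.v (galAdicCompletionMap (L := L) (IsCMField.complexConj L) hw τ - τ) =
      max (Valued.v u ^ 2) (Valued.v (2 : v.adicCompletion ↥(maximalRealSubfield L)) ^ 2 * WithZero.exp (-1 : ℤ)) := by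
  rw [valued_galAdicCompletionMap_sub_self_of_uniformizer L v w hw he hτ htr, valued_toPlace_eq_sq_of_ramified L v w hw he,
    valued_two_mul_of_uniformizer L v w hw he hτ]

/-! ## §3 `τ`-independence -/

include hw he in
/-- The `τ`-coordinate of a uniformiser is a unit: if `τ′ = ι p + ι q τ` is a uniformiser then `|q| = 1` (and `|p| < 1`). [cite: Serre1979, Ch. I §6 Prop. 18] -/
theorem valued_eq_one_of_uniformizer_eq_toPlace_add_toPlace_mul {τ : w.1.adicCompletion L} (hτ : Valued.v τ = WithZero.exp (-1 : ℤ))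
    {p q : v.adicCompletion ↥(maximalRealSubfield L)} (hτ' : Valued.v (toPlace v w p + toPlace v w q * τ) = WithZero.exp (-1 : ℤ)) :
    Valued.v q = 1 := by
  rw [valued_toPlace_add_toPlace_mul L v w hw he hτ] at hτ'
  rcases max_eq_iff.1 hτ' with ⟨hp, -⟩ | ⟨hq, -⟩
  · exact absurd (by rw [valued_toPlace_eq_sq_of_ramified L v w hw he, hp]) (valued_toPlace_ne_exp_neg_one L v w hw he p)
  · have h1 : Valued.v q ^ 2 = 1 := by
      have hexp : WithZero.exp (-1 : ℤ) ≠ 0 := WithZero.coe_ne_zero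
      calc Valued.v q ^ 2 = Valued.v q ^ 2 * WithZero.exp (-1 : ℤ) * (WithZero.exp (-1 : ℤ))⁻¹ := by rw [mul_inv_cancel_right₀ hexp]
        _ = 1 := by rw [hq, mul_inv_cancel₀ hexp]
    exact eq_one_of_sq_eq_one' h1

include he in
/-- **`τ`-INDEPENDENCE OF THE DIFFERENT NUMBER**: for any two uniformisers `τ, τ′` of `L_w`, `|στ′ − τ′| = |στ − τ|` (`τ′ = ι p + ι q τ` with `|q| = 1`, and §1).
[cite: Serre1979, Ch. IV §1 Prop. 4] [cite: Serre1979, Ch. III §6 Cor. 2] -/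
theorem valued_galAdicCompletionMap_sub_self_eq_of_uniformizer {τ τ' : w.1.adicCompletion L} (hτ : Valued.v τ = WithZero.exp (-1 : ℤ))
    (hτ' : Valued.v τ' = WithZero.exp (-1 : ℤ)) :
    Valued.v (galAdicCompletionMap (L := L) (IsCMField.complexConj L) hw τ' - τ') = Valued.v (galAdicCompletionMap (L := L) (IsCMField.complexConj L) hw τ - τ) := by
  obtain ⟨p, q, hpq⟩ := exists_eq_toPlace_add_toPlace_mul L v w hw he hτ τ'
  have hq : Valued.v q = 1 := valued_eq_one_of_uniformizer_eq_toPlace_add_toPlace_mul L v w hw he hτ (by rw [← hpq, hτ'])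
  rw [hpq, valued_galAdicCompletionMap_sub_self_toPlace_add_toPlace_mul L v w hw he τ p q, hq, one_pow, one_mul]

/-! ## §4 Bounds, and `d = 1 ⟺ tame` -/

include he in
/-- Lower bound: `|2τ| ≤ |στ − τ|` (i.e. `d ≤ 2·ord_v 2 + 1`). [cite: Serre1979, Ch. IV §2 Ex. 3] -/
theorem valued_two_mul_le_valued_galAdicCompletionMap_sub_self {τ : w.1.adicCompletion L} (hτ : Valued.v τ = WithZero.exp (-1 : ℤ)) :
    Valued.v (2 * τ) ≤ Valued.v (galAdicCompletionMap (L := L) (IsCMField.complexConj L) hw τ - τ) := by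
  obtain ⟨u, v₀, htr, -, -, -⟩ := exists_eisenstein_coeffs_of_ramified L v w hw he hτ
  rw [valued_galAdicCompletionMap_sub_self_of_uniformizer L v w hw he hτ htr]
  exact le_max_right _ _

/-- Upper bound: `|στ − τ| ≤ exp(−1)` (i.e. `1 ≤ d`). [cite: Serre1979, Ch. IV §1] -/
theorem valued_galAdicCompletionMap_sub_self_le_exp_neg_one {τ : w.1.adicCompletion L} (hτ : Valued.v τ = WithZero.exp (-1 : ℤ)) :
    Valued.v (galAdicCompletionMap (L := L) (IsCMField.complexConj L) hw τ - τ) ≤ WithZero.exp (-1 : ℤ) := by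
  refine le_trans (Valuation.map_sub _ _ _) ?_
  rw [valued_galAdicCompletionMap, hτ, max_self]

include he in
/-- `στ ≠ τ`, so `|στ − τ| ≠ 0`. [cite: Serre1979, Ch. IV §1] -/
theorem valued_galAdicCompletionMap_sub_self_ne_zero {τ : w.1.adicCompletion L} (hτ : Valued.v τ = WithZero.exp (-1 : ℤ)) :
    Valued.v (galAdicCompletionMap (L := L) (IsCMField.complexConj L) hw τ - τ) ≠ 0 :=
  (Valuation.ne_zero_iff _).2 (sub_ne_zero.2 (galAdicCompletionMap_ne_self_of_uniformizer L v w hw he hτ))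

include he in
/-- **`d = 1 ⟺ TAME`**: `|στ − τ| = exp(−1) ↔ |2|_w = 1`.  (⇒: in `max |ι u| |2τ| = exp(−1)` the even term `|ι u|` cannot be `exp(−1)`, so `|2τ| = exp(−1)`; ⇐: `exp(−1) = |2τ| ≤
|στ − τ| ≤ exp(−1)`.)  This is exactly the scope of the tame frame `σ_w ϖ = −ϖ ∧ |2|_w = 1` (★ `ramifiedBlock_adicCompletion`). [cite: Serre1979, Ch. IV §1 Prop. 4, Ch. IV §2] -/
theorem valued_galAdicCompletionMap_sub_self_eq_exp_neg_one_iff {τ : w.1.adicCompletion L} (hτ : Valued.v τ = WithZero.exp (-1 : ℤ)) :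
    Valued.v (galAdicCompletionMap (L := L) (IsCMField.complexConj L) hw τ - τ) = WithZero.exp (-1 : ℤ) ↔ Valued.v (2 : w.1.adicCompletion L) = 1 := by
  have h2τ : Valued.v (2 * τ) = Valued.v (2 : w.1.adicCompletion L) * WithZero.exp (-1 : ℤ) := by rw [map_mul, hτ]
  have hexp : WithZero.exp (-1 : ℤ) ≠ 0 := WithZero.coe_ne_zero
  constructor
  · intro h
    obtain ⟨u, v₀, htr, -, -, -⟩ := exists_eisenstein_coeffs_of_ramified L v w hw he hτ
    rw [valued_galAdicCompletionMap_sub_self_of_uniformizer L v w hw he hτ htr] at h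
    rcases max_eq_iff.1 h with ⟨hu, -⟩ | ⟨h2, -⟩
    · exact absurd hu (valued_toPlace_ne_exp_neg_one L v w hw he u)
    · rw [h2τ] at h2
      calc Valued.v (2 : w.1.adicCompletion L) = Valued.v (2 : w.1.adicCompletion L) * WithZero.exp (-1 : ℤ) * (WithZero.exp (-1 : ℤ))⁻¹ := by
            rw [mul_inv_cancel_right₀ hexp]
        _ = 1 := by rw [h2, mul_inv_cancel₀ hexp]
  · intro h2
    refine le_antisymm (valued_galAdicCompletionMap_sub_self_le_exp_neg_one L v w hw hτ) ?_
    have h := valued_two_mul_le_valued_galAdicCompletionMap_sub_self L v w hw he hτ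
    rwa [h2τ, h2, one_mul] at h

/-! ## §5 The skew line and the uniformiser ∕ unit criterion -/

/-- `τ − στ` is skew: `σ(τ − στ) = −(τ − στ)`. [cite: Serre1979, Ch. IV §2] -/
theorem galAdicCompletionMap_sub_galAdicCompletionMap_self (τ : w.1.adicCompletion L) :
    galAdicCompletionMap (L := L) (IsCMField.complexConj L) hw (τ - galAdicCompletionMap (L := L) (IsCMField.complexConj L) hw τ) =
      -(τ - galAdicCompletionMap (L := L) (IsCMField.complexConj L) hw τ) := by
  rw [map_sub, galAdicCompletionMap_galAdicCompletionMap_of_smul_eq (IsCMField.complexConj L) w (IsCMField.complexConj_ne_one L) hw, neg_sub]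

include he in
/-- **THE SKEW LINE**: `σ x = −x ↔ ∃ q ∈ L⁺_v, x = ι q · (τ − στ)` — the skew elements form the `ι(L⁺_v)`-line through `τ − στ` (`x ∕ (τ − στ)` is `σ`-fixed, hence
descends by ★ `exists_toPlace_eq_of_galAdicCompletionMap_eq`). [cite: Serre1979, Ch. IV §2] [cite: Jacobowitz1962, §9] -/
theorem galAdicCompletionMap_eq_neg_iff {τ : w.1.adicCompletion L} (hτ : Valued.v τ = WithZero.exp (-1 : ℤ)) (x : w.1.adicCompletion L) :
    galAdicCompletionMap (L := L) (IsCMField.complexConj L) hw x = -x ↔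
      ∃ q : v.adicCompletion ↥(maximalRealSubfield L), x = toPlace v w q * (τ - galAdicCompletionMap (L := L) (IsCMField.complexConj L) hw τ) := by
  have hc1 : IsCMField.complexConj L ≠ 1 := IsCMField.complexConj_ne_one L
  have hδσ := galAdicCompletionMap_sub_galAdicCompletionMap_self L v w hw τ
  constructor
  · intro hx
    have hδ : τ - galAdicCompletionMap (L := L) (IsCMField.complexConj L) hw τ ≠ 0 :=
      fun h => galAdicCompletionMap_ne_self_of_uniformizer L v w hw he hτ (sub_eq_zero.1 h).symm
    have hfix : galAdicCompletionMap (L := L) (IsCMField.complexConj L) hw (x * (τ - galAdicCompletionMap (L := L) (IsCMField.complexConj L) hw τ)⁻¹) =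
        x * (τ - galAdicCompletionMap (L := L) (IsCMField.complexConj L) hw τ)⁻¹ := by
      rw [map_mul, map_inv₀, hx, hδσ, inv_neg, neg_mul_neg]
    obtain ⟨q, hq⟩ := exists_toPlace_eq_of_galAdicCompletionMap_eq (IsCMField.complexConj L) w hc1 hw _ hfix
    exact ⟨q, by rw [hq, inv_mul_cancel_right₀ hδ]⟩
  · rintro ⟨q, rfl⟩
    rw [map_mul, galAdicCompletionMap_toPlace (IsCMField.complexConj L) w w hw q, hδσ, mul_neg]

include he in
/-- The valuation of a skew element is `|q|² · |στ − τ|`: all skew valuations are `≡ d (mod 2)`. [cite: Serre1979, Ch. IV §2] [cite: Jacobowitz1962, §9] -/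
theorem exists_valued_eq_sq_mul_of_galAdicCompletionMap_eq_neg {τ : w.1.adicCompletion L} (hτ : Valued.v τ = WithZero.exp (-1 : ℤ)) {x : w.1.adicCompletion L}
    (hx : galAdicCompletionMap (L := L) (IsCMField.complexConj L) hw x = -x) :
    ∃ q : v.adicCompletion ↥(maximalRealSubfield L), Valued.v x = Valued.v q ^ 2 * Valued.v (galAdicCompletionMap (L := L) (IsCMField.complexConj L) hw τ - τ) := by
  obtain ⟨q, rfl⟩ := (galAdicCompletionMap_eq_neg_iff L v w hw he hτ x).1 hx
  exact ⟨q, by rw [map_mul, valued_toPlace_eq_sq_of_ramified L v w hw he, Valuation.map_sub_swap]⟩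

include he in
/-- **A SKEW UNIFORMISER EXISTS IFF `d` IS ODD, i.e. `|στ − τ| = |2τ|` (`d = 2·ord_v 2 + 1`).**  (⇒: for a skew uniformiser `ϖ`, `σϖ − ϖ = −2ϖ` and §3; ⇐: `ϖ := τ − ι u∕2 =
(τ − στ)∕2` is skew of valuation `|στ − τ| ∕ |2| = |τ|`.)  At a tame place `d = 1` is odd: this is ★ `exists_uniformizer_galAdicCompletionMap_complexConj_eq_neg_of_ramified`;
at a wild place it singles out the `L⁺_v(√π)`-type places (Jacobowitz's «R-P»). [cite: Serre1979, Ch. IV §2] [cite: Jacobowitz1962, §§9–11] -/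
theorem exists_skew_uniformizer_iff {τ : w.1.adicCompletion L} (hτ : Valued.v τ = WithZero.exp (-1 : ℤ)) :
    (∃ ϖ : w.1.adicCompletion L, Valued.v ϖ = WithZero.exp (-1 : ℤ) ∧ galAdicCompletionMap (L := L) (IsCMField.complexConj L) hw ϖ = -ϖ) ↔
      Valued.v (galAdicCompletionMap (L := L) (IsCMField.complexConj L) hw τ - τ) = Valued.v (2 * τ) := by
  constructor
  · rintro ⟨ϖ, hϖ, hσϖ⟩
    rw [← valued_galAdicCompletionMap_sub_self_eq_of_uniformizer L v w hw he hτ hϖ, hσϖ, show -ϖ - ϖ = -(2 * ϖ) by ring, Valuation.map_neg,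
      map_mul, map_mul, hϖ, hτ]
  · intro hd
    obtain ⟨u, v₀, htr, -, -, -⟩ := exists_eisenstein_coeffs_of_ramified L v w hw he hτ
    have h2 : (2 : w.1.adicCompletion L) ≠ 0 := two_ne_zero_adicCompletion L v w
    -- `ϖ := (τ − στ) / 2 = ι(2⁻¹) · (τ − στ)`
    refine ⟨toPlace v w 2⁻¹ * (τ - galAdicCompletionMap (L := L) (IsCMField.complexConj L) hw τ), ?_,
      (galAdicCompletionMap_eq_neg_iff L v w hw he hτ _).2 ⟨2⁻¹, rfl⟩⟩
    rw [map_inv₀, map_ofNat, map_mul, map_inv₀, Valuation.map_sub_swap, hd, map_mul, inv_mul_cancel_left₀ ((Valuation.ne_zero_iff _).2 h2), hτ]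

include he in
/-- **A SKEW UNIT EXISTS IFF `d` IS EVEN, i.e. `|2τ| < |στ − τ|`.**  (⇒: a skew unit `α = ι q (τ − στ)` gives `|q|² |στ − τ| = 1`, an even exponent, so `|στ − τ| ≠ |2τ|`; ⇐:
then `|στ − τ| = |ι u|` with `u ≠ 0` and `α := ι u⁻¹ · (τ − στ)` is a skew unit.)  Wild places of `L⁺_v(√u)`-type only (Jacobowitz's «R-U»); impossible at a tame place
(★ `valued_lt_one_of_galAdicCompletionMap_eq_neg`). [cite: Serre1979, Ch. IV §2] [cite: Jacobowitz1962, §§9–11] -/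
theorem exists_skew_unit_iff {τ : w.1.adicCompletion L} (hτ : Valued.v τ = WithZero.exp (-1 : ℤ)) :
    (∃ α : w.1.adicCompletion L, Valued.v α = 1 ∧ galAdicCompletionMap (L := L) (IsCMField.complexConj L) hw α = -α) ↔
      Valued.v (2 * τ) < Valued.v (galAdicCompletionMap (L := L) (IsCMField.complexConj L) hw τ - τ) := by
  obtain ⟨u, v₀, htr, -, -, -⟩ := exists_eisenstein_coeffs_of_ramified L v w hw he hτ
  have hval := valued_galAdicCompletionMap_sub_self_of_uniformizer L v w hw he hτ htr
  constructor
  · rintro ⟨α, hα, hσα⟩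
    obtain ⟨q, hq⟩ := exists_valued_eq_sq_mul_of_galAdicCompletionMap_eq_neg L v w hw he hτ hσα
    rw [hα] at hq
    refine lt_of_le_of_ne (valued_two_mul_le_valued_galAdicCompletionMap_sub_self L v w hw he hτ) fun h2d => ?_
    -- parity: `1 = |q|² · |2|_v² · exp(-1)` is impossible
    have hq0 : Valued.v q ≠ 0 := by
      intro h0; rw [h0, zero_pow two_ne_zero, zero_mul] at hq; exact one_ne_zero hq
    rw [← h2d, valued_two_mul_of_uniformizer L v w hw he hτ, ← mul_assoc, ← mul_pow] at hq
    have h1 : (1 : WithZero (Multiplicative ℤ)) ^ 2 = (Valued.v q * Valued.v (2 : v.adicCompletion ↥(maximalRealSubfield L))) ^ 2 * WithZero.exp (-1 : ℤ) := by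
      rw [one_pow]; exact hq
    exact sq_ne_sq_mul_exp_neg_one one_ne_zero
      (mul_ne_zero hq0 ((Valuation.ne_zero_iff _).2 (two_ne_zero_adicCompletion_base L v))) h1
  · intro hlt
    -- `|στ − τ| = |ι u|` and `u ≠ 0`
    have hmax : Valued.v (galAdicCompletionMap (L := L) (IsCMField.complexConj L) hw τ - τ) = Valued.v (toPlace v w u) := by
      rw [hval] at hlt ⊢
      rcases le_total (Valued.v (toPlace v w u)) (Valued.v (2 * τ)) with h | h
      · rw [max_eq_right h] at hlt; exact absurd hlt (lt_irrefl _)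
      · exact max_eq_left h
    have hu0 : u ≠ 0 := by
      rintro rfl
      rw [map_zero, map_zero] at hmax
      exact valued_galAdicCompletionMap_sub_self_ne_zero L v w hw he hτ hmax
    have hιu : toPlace v w u ≠ 0 := (_root_.map_ne_zero (toPlace v w)).2 hu0
    refine ⟨toPlace v w u⁻¹ * (τ - galAdicCompletionMap (L := L) (IsCMField.complexConj L) hw τ), ?_,
      (galAdicCompletionMap_eq_neg_iff L v w hw he hτ _).2 ⟨u⁻¹, rfl⟩⟩
    rw [map_inv₀, map_mul, map_inv₀, Valuation.map_sub_swap, hmax, inv_mul_cancel₀ ((Valuation.ne_zero_iff _).2 hιu)]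

include he in
/-- Never both: a skew uniformiser and a skew unit cannot coexist (`d` is odd or even). [cite: Jacobowitz1962, §9] -/
theorem not_exists_skew_uniformizer_and_skew_unit {τ : w.1.adicCompletion L} (hτ : Valued.v τ = WithZero.exp (-1 : ℤ)) :
    ¬ ((∃ ϖ : w.1.adicCompletion L, Valued.v ϖ = WithZero.exp (-1 : ℤ) ∧ galAdicCompletionMap (L := L) (IsCMField.complexConj L) hw ϖ = -ϖ) ∧
       (∃ α : w.1.adicCompletion L, Valued.v α = 1 ∧ galAdicCompletionMap (L := L) (IsCMField.complexConj L) hw α = -α)) := by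
  rintro ⟨hϖ, hα⟩
  rw [exists_skew_uniformizer_iff L v w hw he hτ] at hϖ
  rw [exists_skew_unit_iff L v w hw he hτ] at hα
  exact absurd hϖ (ne_of_gt hα)

/-! ## §6 Residual depth: `σ_w ≡ id (mod 𝔭_w^d)` -/

include he in
/-- **`|σ x − x| ≤ |στ − τ|` for every `x ∈ 𝒪_w`** (`x = ι p + ι q τ` with `p, q ∈ 𝒪_v` by the integral basis, and §1): `σ_w` acts trivially on `𝒪_w ∕ 𝔭_w^d` — the sharp form of
★ `valued_galAdicCompletionMap_sub_lt_one_of_ramified`. [cite: Serre1979, Ch. IV §1 Prop. 4, Ch. IV §2] -/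
theorem valued_galAdicCompletionMap_sub_self_le_of_mem_integer {τ : w.1.adicCompletion L} (hτ : Valued.v τ = WithZero.exp (-1 : ℤ)) {x : w.1.adicCompletion L}
    (hx : Valued.v x ≤ 1) :
    Valued.v (galAdicCompletionMap (L := L) (IsCMField.complexConj L) hw x - x) ≤ Valued.v (galAdicCompletionMap (L := L) (IsCMField.complexConj L) hw τ - τ) := by
  obtain ⟨p, q, rfl⟩ := exists_eq_toPlace_add_toPlace_mul L v w hw he hτ x
  obtain ⟨-, hq⟩ := (toPlace_add_toPlace_mul_mem_integer_iff L v w hw he hτ p q).1 ((v_le_one_iff_mem_integer _).1 hx)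
  rw [valued_galAdicCompletionMap_sub_self_toPlace_add_toPlace_mul L v w hw he τ p q]
  have hq1 : Valued.v q ≤ 1 := (v_le_one_iff_mem_integer q).2 hq
  calc Valued.v q ^ 2 * Valued.v (galAdicCompletionMap (L := L) (IsCMField.complexConj L) hw τ - τ)
      ≤ 1 ^ 2 * Valued.v (galAdicCompletionMap (L := L) (IsCMField.complexConj L) hw τ - τ) := by gcongr
    _ = _ := by rw [one_pow, one_mul]

include he in
/-- Equality case: for `x = ι p + ι q τ` with `|q| = 1`, `|σ x − x| = |στ − τ|`; in particular for every UNIFORMISER and every skew UNIT `x`. [cite: Serre1979, Ch. IV §1 Prop. 4] -/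
theorem valued_galAdicCompletionMap_sub_self_eq_of_valued_eq_one (τ : w.1.adicCompletion L) {p q : v.adicCompletion ↥(maximalRealSubfield L)} (hq : Valued.v q = 1) :
    Valued.v (galAdicCompletionMap (L := L) (IsCMField.complexConj L) hw (toPlace v w p + toPlace v w q * τ) - (toPlace v w p + toPlace v w q * τ)) =
      Valued.v (galAdicCompletionMap (L := L) (IsCMField.complexConj L) hw τ - τ) := by
  rw [valued_galAdicCompletionMap_sub_self_toPlace_add_toPlace_mul L v w hw he τ p q, hq, one_pow, one_mul]

/-! ## §7 One package -/

include he in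
/-- **THE DIFFERENT NUMBER AT A RAMIFIED CM PLACE — ONE PACKAGE.**  At a ramified place `w ∣ v` of the CM extension `L ∕ L⁺` (ANY residue characteristic) there is `d : ℕ` with
`1 ≤ d` such that: every uniformiser `τ` of `L_w` has `|σ_w τ − τ| = exp(−d)`; `|σ_w x − x| ≤ exp(−d)` on `𝒪_w`; `exp(−d) ≥ |2|_w · exp(−1)` (`d ≤ 2·ord_v 2 + 1`);
`d = 1 ↔ |2|_w = 1` (tame); a skew UNIFORMISER exists iff `exp(−d) = |2|_w · exp(−1)`, a skew UNIT iff `|2|_w · exp(−1) < exp(−d)`.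
[cite: Serre1979, Ch. IV §1 Prop. 4, Ch. IV §2, Ch. III §6 Cor. 2] [cite: Jacobowitz1962, §§9–11] -/
theorem exists_different_of_ramified :
    ∃ d : ℕ, 1 ≤ d ∧
      (∀ τ : w.1.adicCompletion L, Valued.v τ = WithZero.exp (-1 : ℤ) →
        Valued.v (galAdicCompletionMap (L := L) (IsCMField.complexConj L) hw τ - τ) = WithZero.exp (-(d : ℤ))) ∧
      (∀ x : w.1.adicCompletion L, Valued.v x ≤ 1 →
        Valued.v (galAdicCompletionMap (L := L) (IsCMField.complexConj L) hw x - x) ≤ WithZero.exp (-(d : ℤ))) ∧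
      Valued.v (2 : w.1.adicCompletion L) * WithZero.exp (-1 : ℤ) ≤ WithZero.exp (-(d : ℤ)) ∧
      (d = 1 ↔ Valued.v (2 : w.1.adicCompletion L) = 1) ∧
      ((∃ ϖ : w.1.adicCompletion L, Valued.v ϖ = WithZero.exp (-1 : ℤ) ∧ galAdicCompletionMap (L := L) (IsCMField.complexConj L) hw ϖ = -ϖ) ↔
        WithZero.exp (-(d : ℤ)) = Valued.v (2 : w.1.adicCompletion L) * WithZero.exp (-1 : ℤ)) ∧
      ((∃ α : w.1.adicCompletion L, Valued.v α = 1 ∧ galAdicCompletionMap (L := L) (IsCMField.complexConj L) hw α = -α) ↔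
        Valued.v (2 : w.1.adicCompletion L) * WithZero.exp (-1 : ℤ) < WithZero.exp (-(d : ℤ))) := by
  -- a uniformiser `τ` and the value `D := |στ − τ| ≠ 0`, `≤ exp(-1)`
  obtain ⟨π, hπ⟩ := w.1.valuation_exists_uniformizer L
  have hτ : Valued.v (π : w.1.adicCompletion L) = WithZero.exp (-1 : ℤ) := by rw [HeightOneSpectrum.valuedAdicCompletion_eq_valuation', hπ]
  set τ : w.1.adicCompletion L := (π : w.1.adicCompletion L) with hτdef
  set D := Valued.v (galAdicCompletionMap (L := L) (IsCMField.complexConj L) hw τ - τ) with hDdef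
  have hD0 : D ≠ 0 := valued_galAdicCompletionMap_sub_self_ne_zero L v w hw he hτ
  have hD1 : D ≤ WithZero.exp (-1 : ℤ) := valued_galAdicCompletionMap_sub_self_le_exp_neg_one L v w hw hτ
  obtain ⟨m, hm⟩ : ∃ m : ℤ, D = WithZero.exp m := ⟨_, (WithZero.exp_log hD0).symm⟩
  have hm1 : m ≤ -1 := by rw [hm, WithZero.exp_le_exp] at hD1; exact hD1
  obtain ⟨d, hd⟩ : ∃ d : ℕ, (d : ℤ) = -m := ⟨(-m).toNat, Int.toNat_of_nonneg (by omega)⟩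
  have hDd : D = WithZero.exp (-(d : ℤ)) := by rw [hm, hd, neg_neg]
  have h2τ : Valued.v (2 * τ) = Valued.v (2 : w.1.adicCompletion L) * WithZero.exp (-1 : ℤ) := by rw [map_mul, hτ]
  refine ⟨d, by omega, fun τ' hτ' => ?_, fun x hx => ?_, ?_, ?_, ?_, ?_⟩
  · rw [valued_galAdicCompletionMap_sub_self_eq_of_uniformizer L v w hw he hτ hτ', ← hDdef, hDd]
  · exact (valued_galAdicCompletionMap_sub_self_le_of_mem_integer L v w hw he hτ hx).trans hDd.le
  · rw [← h2τ, ← hDd]; exact valued_two_mul_le_valued_galAdicCompletionMap_sub_self L v w hw he hτ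
  · rw [← valued_galAdicCompletionMap_sub_self_eq_exp_neg_one_iff L v w hw he hτ, ← hDdef, hDd, WithZero.exp_inj]; omega
  · rw [exists_skew_uniformizer_iff L v w hw he hτ, ← hDdef, hDd, h2τ]
  · rw [exists_skew_unit_iff L v w hw he hτ, ← hDdef, hDd, h2τ]

end Literature.NumberTheory.Automorphic.UnitaryGroup

end
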